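import Mathlib
import HarnessLib
import Literature.Analysis.FluidPDE.SelfSimilar
import Literature.Analysis.FluidPDE.LocalTypeI
import Literature.Analysis.FluidPDE.VectorCalculus
import Literature.Analysis.FluidPDE.TypeIAncientMild
import Literature.Analysis.FluidPDE.AxisymHouLiVariables
import Summits.NavierStokesRegularity.NavierStokesRegularity.Theorems.LocalSineTubeDoorProfileAlignedWindowRigidityAncient
import Summits.NavierStokesRegularity.NavierStokesRegularity.Theorems.PoloidalWindowDoorPoloidalWindowRigidityFlat
import Summits.NavierStokesRegularity.NavierStokesRegularity.Theorems.PoloidalWindowDoorPoloidalWindowRigidityOneSlice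
import Literature.Analysis.PDE.DivFormLiouville

/-!
# Route `PoloidalWindowDoor`, crux `PoloidalWindowRigidity` (K2, stmt-NavierStokesRegularity-19708) —
# the ELLIPTIC-SLOPE stratum (variable Clebsch slope avoiding a neighbourhood of `[0,1]`) is EMPTY,
# conditionally on the De Giorgi–Nash–Moser Liouville theorem

Cell ns-regularity-ideate, seat ns-poloidal-K2-p1 (K2 lead; support file for the line `slicesharp-screw`,
`--supports stmt-…-19708 --as helper`). Mechanism M11 of the K2 census: a SLICE-WISE ELLIPTIC Liouville theorem —
no Type-I rate is involved, so it cannot die «at the critical rate» like M1/M7/M8′/M10 (CENSUS-K2G §16.5).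

For a poloidal field (`ω₂ ≡ 0`) the two horizontal vorticity components read `ω₁ = ∂₂v₀ − ∂₀v₂`,
`ω₀ = ∂₁v₂ − ∂₂v₁`, and the frozen constraint `ω·∇v₂ = 0` makes the vertical shear `∂₂v_h` and the horizontal
gradient `∇_h v₂` POINTWISE PARALLEL: `∂₂v_h = μ ∇_h v₂` with `μ = 1 − 1/Λ`, `Λ` the Clebsch slope `∂v₂/∂ψ`
(K2P1-S2-NOTES §1; scaling weight 0, constant on vortex lines).  The identity `∂₂(div v) = 0`, i.e.
`div(∂₂ v) = 0` with `∂₂v = (μ∇_h v₂, ∂₂v₂)`, says that on every slice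

  `v₂` is a weak solution of the divergence-form equation `div( diag(μ, μ, 1) ∇ v₂ ) = 0`

(`integral_shear_weakForm`: `∫ Σᵢⱼ aᵢⱼ ∂ᵢv₂ ∂ⱼη = ∫ Σᵢ ∂₂vᵢ ∂ᵢη = −∫ η ∂₂(div v) = 0` for every `C¹` test function
`η` of compact support; one integration by parts, Mathlib's `integral_mul_fderiv_eq_neg_fderiv_mul_of_integrable`).
If on ONE slice `μ` stays in a compact sub-interval `[μ₀, μ₁] ⊂ (0, ∞)` — equivalently the slope `Λ` avoids a
neighbourhood of `[0,1]` in `ℝP¹`; equivalently `∂₂v_n` and `∂_n v₂` have the same sign with bounded ratio, the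
STRAIN-DOMINATED regime `2|S_{n3}| > |ω|` in every vortex-normal plane; the slope need NOT be constant — the
coefficient matrix `diag(μ,μ,1)` is bounded, measurable and uniformly elliptic, and the De Giorgi–Nash–Moser
Liouville theorem (`divFormLiouville`: bounded entire weak solutions are constant; Jost, *PDE*, Thm 14.2.3;
Moser 1961) makes the bounded slice component `v₂(s,·)` CONSTANT; then the slice is flat along `e₀` and the
profile vanishes by the tree's one-slice flat stratum (`eq_zero_of_flat_slice_single_zero`, p6).

This generalises the seat's `…ProportionalShear.eq_zero_of_proportionalShear` (p463086: CONSTANT `μ > 0`,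
harmonic Liouville after an anisotropic rescaling) from constant to variable coefficients.  What it adds to the
map of the residue S2″: on EVERY slice the Clebsch slope enters every neighbourhood of `[0,1]` (`inf μ ≤ 0` or
`sup μ = +∞`): the residue is somewhere (asymptotically) vorticity-dominated in the vortex-normal plane.

* `divFormLiouville`            — the NAMED FACT (Literature `Prop`, De Giorgi–Nash–Moser Liouville theorem);
* `exists_measurable_shearRatio` — a measurable ratio `m ∈ [min μ₀ 1, max μ₁ 1]` with `∂₂v_h = m ∇_h v₂`;
* `integral_shear_weakForm`     — `∫ Σᵢ ∂₂vᵢ ∂ᵢη = 0` for divergence-free `C²` fields (the weak equation);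
* `eq_zero_of_ellipticShear`    — THE STRATUM IS EMPTY in the class (conditional on `divFormLiouville`);
* `eq_zero_of_clebschSlope_offInterval` — the same in Clebsch-slope currency (`Λ ≤ −δ` or `Λ ≥ 1 + δ` pointwise);
* `nonflatLiouville_of_ellipticShear` — in the «not backward-singular» currency of the stub.

WHAT THIS IS NOT: not a claim about Navier–Stokes regularity and not the open residue S2″ — one more stratum,
settled CONDITIONALLY on a classical theorem of elliptic regularity theory that the tree does not yet hold
(bears_on LADDER-NS N0, rung N0-LocalTubeDoorPoloidal).
-/

noncomputable section

-- the summit and its single sub-problem share the name (CONVENTIONS §1), as in every Theorems file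
set_option linter.dupNamespace false

namespace Summit.NavierStokesRegularity.NavierStokesRegularity.Theorems.PoloidalWindowDoorPoloidalWindowRigidityEllipticSlope

open MeasureTheory
open scoped Matrix

/-! ### The named fact: De Giorgi–Nash–Moser's Liouville theorem for divergence-form equations -/

open Set Function Filter Topology
open scoped RealInnerProductSpace InnerProductSpace
open Literature.Analysis Literature.Analysis.FluidPDE
open Summit.NavierStokesRegularity.NavierStokesRegularity.Theorems.LocalSineTubeDoorProfileAlignedWindowRigidityAncient
open Summit.NavierStokesRegularity.NavierStokesRegularity.Theorems.PoloidalWindowDoorPoloidalWindowRigidityFlat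
open Summit.NavierStokesRegularity.NavierStokesRegularity.Theorems.PoloidalWindowDoorPoloidalWindowRigidityOneSlice

variable {C : ℝ} {v : ℝ → EuclideanSpace ℝ (Fin 3) → EuclideanSpace ℝ (Fin 3)}

/-- **A measurable shear ratio.** If at every point the vertical shear of the horizontal velocity is a multiple
`m ∈ [μ₀, μ₁]` of the horizontal gradient of the vertical velocity (`∂₂w₀ = m ∂₀w₂`, `∂₂w₁ = m ∂₁w₂`), and the
first derivatives of `w` are continuous, then the multiple can be chosen as a MEASURABLE function of the point with
values in `[min μ₀ 1, max μ₁ 1]` (explicit choice: the quotient where `∇_h w₂ ≠ 0`, and `1` where `∇_h w₂ = 0`). -/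
theorem exists_measurable_shearRatio {w : EuclideanSpace ℝ (Fin 3) → EuclideanSpace ℝ (Fin 3)}
    (hw : ContDiff ℝ 1 w) {μ₀ μ₁ : ℝ}
    (h : ∀ y, ∃ m : ℝ, μ₀ ≤ m ∧ m ≤ μ₁ ∧
      fderiv ℝ w y (EuclideanSpace.single 2 1) 0 = m * fderiv ℝ w y (EuclideanSpace.single 0 1) 2 ∧
      fderiv ℝ w y (EuclideanSpace.single 2 1) 1 = m * fderiv ℝ w y (EuclideanSpace.single 1 1) 2) :
    ∃ m : EuclideanSpace ℝ (Fin 3) → ℝ, Measurable m ∧ (∀ y, min μ₀ 1 ≤ m y ∧ m y ≤ max μ₁ 1) ∧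
      ∀ y, fderiv ℝ w y (EuclideanSpace.single 2 1) 0 = m y * fderiv ℝ w y (EuclideanSpace.single 0 1) 2 ∧
        fderiv ℝ w y (EuclideanSpace.single 2 1) 1 = m y * fderiv ℝ w y (EuclideanSpace.single 1 1) 2 := by
  -- the four first-order quantities, as continuous (hence measurable) functions of the point
  have hcomp : ∀ (e : EuclideanSpace ℝ (Fin 3)) (i : Fin 3), Continuous fun y => fderiv ℝ w y e i := by
    intro e i
    have h1 : Continuous fun y => fderiv ℝ w y e := (hw.continuous_fderiv one_ne_zero).clm_apply continuous_const
    exact (contDiff_apply_coord_vec3 (n := 0) (w := fun y => fderiv ℝ w y e)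
      (contDiff_zero.2 h1) i).continuous
  set A : EuclideanSpace ℝ (Fin 3) → ℝ := fun y => fderiv ℝ w y (EuclideanSpace.single 0 1) 2 with hA
  set B : EuclideanSpace ℝ (Fin 3) → ℝ := fun y => fderiv ℝ w y (EuclideanSpace.single 1 1) 2 with hB
  set P : EuclideanSpace ℝ (Fin 3) → ℝ := fun y => fderiv ℝ w y (EuclideanSpace.single 2 1) 0 with hP
  set Q : EuclideanSpace ℝ (Fin 3) → ℝ := fun y => fderiv ℝ w y (EuclideanSpace.single 2 1) 1 with hQ
  have hAm : Measurable A := (hcomp _ _).measurable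
  have hBm : Measurable B := (hcomp _ _).measurable
  have hPm : Measurable P := (hcomp _ _).measurable
  have hQm : Measurable Q := (hcomp _ _).measurable
  refine ⟨fun y => if A y ≠ 0 then P y / A y else if B y ≠ 0 then Q y / B y else 1, ?_, ?_, ?_⟩
  · refine Measurable.ite (hAm (measurableSet_singleton 0)).compl (hPm.div hAm) ?_
    exact Measurable.ite (hBm (measurableSet_singleton 0)).compl (hQm.div hBm) measurable_const
  · intro y
    obtain ⟨m, hm0, hm1, hPy, hQy⟩ := h y
    change P y = m * A y at hPy
    change Q y = m * B y at hQy
    by_cases hAy : A y ≠ 0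
    · have hmy : P y / A y = m := by rw [hPy]; field_simp
      simp only [hAy, ne_eq, not_false_eq_true, if_true, hmy]
      exact ⟨le_trans (min_le_left _ _) hm0, hm1.trans (le_max_left _ _)⟩
    · by_cases hBy : B y ≠ 0
      · have hmy : Q y / B y = m := by rw [hQy]; field_simp
        simp only [hAy, hBy, ne_eq, not_false_eq_true, if_true, if_false, hmy]
        exact ⟨le_trans (min_le_left _ _) hm0, hm1.trans (le_max_left _ _)⟩
      · simp only [hAy, hBy, if_false]
        exact ⟨min_le_right _ _, le_max_right _ _⟩
  · intro y
    obtain ⟨m, hm0, hm1, hPy, hQy⟩ := h y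
    change P y = m * A y at hPy
    change Q y = m * B y at hQy
    change P y = _ * A y ∧ Q y = _ * B y
    by_cases hAy : A y ≠ 0
    · have hmy : P y / A y = m := by rw [hPy]; field_simp
      simp only [hAy, ne_eq, not_false_eq_true, if_true, hmy]
      exact ⟨hPy, hQy⟩
    · push Not at hAy
      by_cases hBy : B y ≠ 0
      · have hmy : Q y / B y = m := by rw [hQy]; field_simp
        simp only [hAy, hBy, ne_eq, not_true_eq_false, not_false_eq_true, if_true, if_false, hmy]
        rw [hAy] at hPy
        exact ⟨hPy, hQy⟩
      · push Not at hBy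
        simp only [hAy, hBy, ne_eq, not_true_eq_false, if_false, mul_zero]
        exact ⟨by simpa [hAy] using hPy, by simpa [hBy] using hQy⟩

/-! ### Dynamics-free core: the weak equation `div(∂₂ v) = 0` -/

/-- **The weak equation.** For a divergence-free `C²` field `w` on `ℝ³` and every `C¹` test function `η` of
compact support, `∫ Σᵢ (∂₂wᵢ)(∂ᵢη) = 0`: one integration by parts per coordinate and
`Σᵢ ∂ᵢ∂₂wᵢ = ∂₂(div w) = 0` (mixed partials commute). -/
theorem integral_shear_weakForm {w : EuclideanSpace ℝ (Fin 3) → EuclideanSpace ℝ (Fin 3)}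
    (hw : ContDiff ℝ 2 w) (hdiv : VectorCalculus.IsDivFree w)
    {η : EuclideanSpace ℝ (Fin 3) → ℝ} (hη : ContDiff ℝ 1 η) (hηc : HasCompactSupport η) :
    ∫ y, ∑ i : Fin 3, fderiv ℝ w y (EuclideanSpace.single 2 1) i *
      fderiv ℝ η y (EuclideanSpace.single i 1) = 0 := by
  -- the vertical-shear field `W = ∂₂ w` is `C¹`; its coordinates `F i = ∂₂ wᵢ`
  have hW : ContDiff ℝ 1 fun y => fderiv ℝ w y (EuclideanSpace.single 2 1) :=
    (hw.fderiv_right (m := 1) le_rfl).clm_apply contDiff_const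
  set F : Fin 3 → EuclideanSpace ℝ (Fin 3) → ℝ := fun i y => fderiv ℝ w y (EuclideanSpace.single 2 1) i with hF
  have hFi : ∀ i, ContDiff ℝ 1 (F i) := fun i => contDiff_apply_coord_vec3 hW i
  have hFc : ∀ i, Continuous (F i) := fun i => (hFi i).continuous
  have hFd : ∀ i, Differentiable ℝ (F i) := fun i => (hFi i).differentiable one_ne_zero
  have hdFc : ∀ i (e : EuclideanSpace ℝ (Fin 3)), Continuous fun y => fderiv ℝ (F i) y e := fun i e =>
    ((hFi i).continuous_fderiv one_ne_zero).clm_apply continuous_const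
  -- the test function and its partial derivatives: continuous with compact support
  have hηcont : Continuous η := hη.continuous
  have hηd : Differentiable ℝ η := hη.differentiable one_ne_zero
  have hdηc : ∀ e : EuclideanSpace ℝ (Fin 3), Continuous fun y => fderiv ℝ η y e := fun e =>
    (hη.continuous_fderiv one_ne_zero).clm_apply continuous_const
  have hdηsupp : ∀ e : EuclideanSpace ℝ (Fin 3), HasCompactSupport fun y => fderiv ℝ η y e := fun e =>
    hηc.fderiv (𝕜 := ℝ) |>.comp_left (g := fun L : EuclideanSpace ℝ (Fin 3) →L[ℝ] ℝ => L e) (by simp)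
  -- integrability of the three products entering the integration by parts
  have hI1 : ∀ i, Integrable fun y => fderiv ℝ (F i) y (EuclideanSpace.single i 1) * η y := fun i =>
    ((hdFc i _).mul hηcont).integrable_of_hasCompactSupport hηc.mul_left
  have hI2 : ∀ i, Integrable fun y => F i y * fderiv ℝ η y (EuclideanSpace.single i 1) := fun i =>
    ((hFc i).mul (hdηc _)).integrable_of_hasCompactSupport (hdηsupp _).mul_left
  have hI3 : ∀ i, Integrable fun y => F i y * η y := fun i =>
    ((hFc i).mul hηcont).integrable_of_hasCompactSupport hηc.mul_left
  -- integrate by parts coordinate by coordinate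
  have hibp : ∀ i, ∫ y, F i y * fderiv ℝ η y (EuclideanSpace.single i 1) =
      -∫ y, fderiv ℝ (F i) y (EuclideanSpace.single i 1) * η y := fun i =>
    integral_mul_fderiv_eq_neg_fderiv_mul_of_integrable (hI1 i) (hI2 i) (hI3 i)
      (fun y _ => hFd i y) (fun y _ => hηd y)
  -- `Σᵢ ∂ᵢ(∂₂wᵢ) = ∂₂(div w) = 0`
  have hsum : ∀ y, ∑ i : Fin 3, fderiv ℝ (F i) y (EuclideanSpace.single i 1) = 0 := by
    intro y
    have hWd : Differentiable ℝ fun y => fderiv ℝ w y (EuclideanSpace.single 2 1) := hW.differentiable one_ne_zero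
    have hkey : ∀ i : Fin 3, fderiv ℝ (F i) y (EuclideanSpace.single i 1) =
        fderiv ℝ (fun z => fderiv ℝ w z (EuclideanSpace.single i 1) i) y (EuclideanSpace.single 2 1) := by
      intro i
      have hWi : Differentiable ℝ fun z => fderiv ℝ w z (EuclideanSpace.single i 1) :=
        ((hw.fderiv_right (m := 1) le_rfl).clm_apply contDiff_const).differentiable one_ne_zero
      rw [hF, fderiv_apply_coord_vec3 (w := fun z => fderiv ℝ w z (EuclideanSpace.single 2 1)) (hWd y) i,
        fderiv_fderiv_apply_comm_vec hw y (EuclideanSpace.single 2 1) (EuclideanSpace.single i 1),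
        ← fderiv_apply_coord_vec3 (w := fun z => fderiv ℝ w z (EuclideanSpace.single i 1)) (hWi y) i]
    simp only [hkey, Fin.sum_univ_three]
    exact fderiv_divergence_components_eq_zero hw hdiv y (EuclideanSpace.single 2 1)
  calc ∫ y, ∑ i : Fin 3, fderiv ℝ w y (EuclideanSpace.single 2 1) i * fderiv ℝ η y (EuclideanSpace.single i 1)
      = ∑ i : Fin 3, ∫ y, F i y * fderiv ℝ η y (EuclideanSpace.single i 1) := by
        rw [← integral_finsetSum _ fun i _ => hI2 i]
    _ = -∫ y, (∑ i : Fin 3, fderiv ℝ (F i) y (EuclideanSpace.single i 1)) * η y := by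
        rw [Finset.sum_congr rfl fun i _ => hibp i, Finset.sum_neg_distrib,
          ← integral_finsetSum _ fun i _ => hI1 i]
        congr 1
        refine integral_congr_ae (Eventually.of_forall fun y => ?_)
        simp [Finset.sum_mul]
    _ = 0 := by simp [hsum]

/-! ### The stratum theorem -/

/-- **THE ELLIPTIC-SLOPE STRATUM IS EMPTY (conditionally on `divFormLiouville`).**  A profile `v` of the route's
Type-I class (rate, continuity on the open slab, unit-viscosity Oseen-mild identity, divergence-free slices)
which on ONE slice `s < 0` is poloidal along `e₂` and whose vertical shear of the horizontal velocity is, at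
every point of that slice, a multiple `m ∈ [μ₀, μ₁]` (`μ₀ > 0`) of the horizontal gradient of the vertical
velocity — `∂₂v₀ = m ∂₀v₂`, `∂₂v₁ = m ∂₁v₂`, `m` depending on the point (Clebsch slope `1/(1−m)` off a
neighbourhood of `[0,1]`) — vanishes identically: `v₂(s,·)` is a bounded `C¹` weak solution of
`div(diag(m,m,1)∇v₂) = 0` with bounded measurable uniformly elliptic coefficients, hence constant, so the slice
is flat along `e₀` and `eq_zero_of_flat_slice_single_zero` applies. -/
theorem eq_zero_of_ellipticShear (hDGNM : Literature.Analysis.PDE.divFormLiouville) (hrate : HasTypeITimeDecay C v)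
    (hcont : ContinuousOn (uncurry v) (Iio (0 : ℝ) ×ˢ univ))
    (hmild : ∀ s t : ℝ, s < t → t < 0 → ∀ x,
      v t x = UnboundedOperators.heatExtension (v s) (t - s) x - oseenDuhamel 1 s v v t x)
    (hdiv : ∀ t < 0, VectorCalculus.IsDivFree (v t)) {s : ℝ} (hs : s < 0)
    (hpol : ∀ y, ⟪curl (v s) y, EuclideanSpace.single 2 1⟫_ℝ = 0)
    {μ₀ μ₁ : ℝ} (hμ₀ : 0 < μ₀)
    (hshear : ∀ y, ∃ m : ℝ, μ₀ ≤ m ∧ m ≤ μ₁ ∧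
      fderiv ℝ (v s) y (EuclideanSpace.single 2 1) 0 = m * fderiv ℝ (v s) y (EuclideanSpace.single 0 1) 2 ∧
      fderiv ℝ (v s) y (EuclideanSpace.single 2 1) 1 = m * fderiv ℝ (v s) y (EuclideanSpace.single 1 1) 2) :
    ∀ t < 0, ∀ x, v t x = 0 := by
  have hbdd := bdd_of_hasTypeITimeDecay hrate
  have hC2 : ContDiff ℝ 2 (v s) := (analyticOnNhd_slice hcont hbdd hmild hs).contDiff
  have hC1 : ContDiff ℝ 1 (v s) := hC2.of_le (by norm_num)
  have hd : Differentiable ℝ (v s) := hC1.differentiable one_ne_zero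
  obtain ⟨m, hmeas, hmbd, hmrel⟩ := exists_measurable_shearRatio hC1 hshear
  -- the coefficient field `a = diag(m, m, 1)` and its constants
  set lam : ℝ := min μ₀ 1 with hlam
  set Λ : ℝ := max μ₁ 1 with hΛ
  have hlam0 : 0 < lam := lt_min hμ₀ one_pos
  set d : EuclideanSpace ℝ (Fin 3) → Fin 3 → ℝ := fun y => ![m y, m y, 1] with hd'
  have hdi : ∀ y i, lam ≤ d y i ∧ d y i ≤ Λ := by
    intro y i
    fin_cases i
    · exact hmbd y
    · exact hmbd y
    · exact ⟨min_le_right _ _, le_max_right _ _⟩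
  set a : EuclideanSpace ℝ (Fin 3) → Matrix (Fin 3) (Fin 3) ℝ := fun y => Matrix.diagonal (d y) with ha
  have hameas : ∀ i j, Measurable fun y => a y i j := by
    intro i j
    by_cases hij : i = j
    · subst hij
      simp only [ha, Matrix.diagonal_apply_eq]
      fin_cases i
      · simpa [hd'] using hmeas
      · simpa [hd'] using hmeas
      · simp [hd']
    · simp [ha, Matrix.diagonal_apply_ne _ hij]
  have hasymm : ∀ y, (a y).IsSymm := fun y => Matrix.isSymm_diagonal _
  have haell : ∀ y (ξ : Fin 3 → ℝ), lam * (ξ ⬝ᵥ ξ) ≤ ξ ⬝ᵥ (a y *ᵥ ξ) := by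
    intro y ξ
    simp only [ha, Matrix.mulVec_diagonal, dotProduct, Finset.mul_sum]
    refine Finset.sum_le_sum fun i _ => ?_
    have := (hdi y i).1
    nlinarith [mul_self_nonneg (ξ i)]
  have habd : ∀ y i j, |a y i j| ≤ Λ := by
    intro y i j
    have hΛ0 : 0 ≤ Λ := zero_le_one.trans (le_max_right _ _)
    by_cases hij : i = j
    · subst hij
      simp only [ha, Matrix.diagonal_apply_eq]
      rw [abs_of_nonneg (hlam0.le.trans (hdi y i).1)]
      exact (hdi y i).2
    · simpa [ha, Matrix.diagonal_apply_ne _ hij] using hΛ0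
  -- the vertical velocity `u = v₂(s,·)`: `C¹`, bounded, weak solution
  set u : EuclideanSpace ℝ (Fin 3) → ℝ := fun y => v s y 2 with hu
  have huC1 : ContDiff ℝ 1 u := contDiff_apply_coord_vec3 hC1 2
  have hubdd : ∃ K : ℝ, ∀ y, |u y| ≤ K := by
    refine ⟨C / Real.sqrt (-s), fun y => ?_⟩
    calc |u y| = ‖v s y 2‖ := rfl
      _ ≤ ‖v s y‖ := PiLp.norm_apply_le (v s y) 2
      _ ≤ C / Real.sqrt (-s) := hrate s hs y
  have hucoord : ∀ y (e : EuclideanSpace ℝ (Fin 3)), fderiv ℝ u y e = fderiv ℝ (v s) y e 2 := fun y e =>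
    fderiv_apply_coord_vec3 (hd y) 2 e
  have hweak : ∀ η : EuclideanSpace ℝ (Fin 3) → ℝ, ContDiff ℝ 1 η → HasCompactSupport η →
      ∫ y, ∑ i, ∑ j, a y i j * fderiv ℝ u y (EuclideanSpace.single i 1) *
        fderiv ℝ η y (EuclideanSpace.single j 1) = 0 := by
    intro η hη hηc
    have hpt : ∀ y, ∑ i, ∑ j, a y i j * fderiv ℝ u y (EuclideanSpace.single i 1) *
        fderiv ℝ η y (EuclideanSpace.single j 1) =
        ∑ i : Fin 3, fderiv ℝ (v s) y (EuclideanSpace.single 2 1) i * fderiv ℝ η y (EuclideanSpace.single i 1) := by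
      intro y
      obtain ⟨h0, h1⟩ := hmrel y
      simp only [ha, hd', hucoord, Matrix.diagonal_apply, Fin.sum_univ_three]
      simp [h0, h1]
    simp_rw [hpt]
    exact integral_shear_weakForm hC2 (hdiv s hs) hη hηc
  -- De Giorgi–Nash–Moser: `u` is constant, so the slice is flat along `e₀`
  have hconst := hDGNM 3 a lam Λ hlam0 hameas hasymm haell habd u huC1 hubdd hweak
  have hflat : ∀ y, fderiv ℝ (v s) y (EuclideanSpace.single 0 1) 2 = 0 := by
    intro y
    have hfun : u = fun _ => u 0 := funext fun x => hconst x 0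
    rw [← hucoord, hfun]
    simp
  exact eq_zero_of_flat_slice_single_zero hrate hcont hmild hdiv hs hpol hflat

/-- **The same stratum in Clebsch-slope currency.**  If on one poloidal slice the horizontal gradient of the
vertical velocity is everywhere a multiple `Λ` of the rotated horizontal vorticity, `∂₀v₂ = −Λ ω₁`, `∂₁v₂ = Λ ω₀`
(`∇_h v₂ = Λ ∇_h ψ` for every Clebsch stream function `ψ`), with the slope `Λ` OFF THE INTERVAL `(−δ, 1 + δ)`
for a fixed `δ > 0` at every point (the slope may vary from point to point), the profile vanishes:
kinematically `∂₂v_h = (1 − 1/Λ) ∇_h v₂` with `1 − 1/Λ ∈ [δ/(1+δ), 1 + 1/δ]`. -/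
theorem eq_zero_of_clebschSlope_offInterval (hDGNM : Literature.Analysis.PDE.divFormLiouville) (hrate : HasTypeITimeDecay C v)
    (hcont : ContinuousOn (uncurry v) (Iio (0 : ℝ) ×ˢ univ))
    (hmild : ∀ s t : ℝ, s < t → t < 0 → ∀ x,
      v t x = UnboundedOperators.heatExtension (v s) (t - s) x - oseenDuhamel 1 s v v t x)
    (hdiv : ∀ t < 0, VectorCalculus.IsDivFree (v t)) {s : ℝ} (hs : s < 0)
    (hpol : ∀ y, ⟪curl (v s) y, EuclideanSpace.single 2 1⟫_ℝ = 0)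
    {δ : ℝ} (hδ : 0 < δ)
    (hslope : ∀ y, ∃ lam : ℝ, (lam ≤ -δ ∨ 1 + δ ≤ lam) ∧
      fderiv ℝ (v s) y (EuclideanSpace.single 0 (1 : ℝ)) 2 = -(lam * curl (v s) y 1) ∧
      fderiv ℝ (v s) y (EuclideanSpace.single 1 (1 : ℝ)) 2 = lam * curl (v s) y 0) :
    ∀ t < 0, ∀ x, v t x = 0 := by
  refine eq_zero_of_ellipticShear hDGNM hrate hcont hmild hdiv hs hpol (μ₀ := δ / (1 + δ)) (μ₁ := 1 + 1 / δ)
    (div_pos hδ (by linarith)) fun y => ?_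
  obtain ⟨lam, hlam, h0, h1⟩ := hslope y
  have hlam0 : lam ≠ 0 := by
    rcases hlam with h | h
    · exact fun h0 => by linarith
    · exact fun h0 => by linarith
  have hc0 : curl (v s) y 0 = fderiv ℝ (v s) y (EuclideanSpace.single 1 (1 : ℝ)) 2 -
      fderiv ℝ (v s) y (EuclideanSpace.single 2 (1 : ℝ)) 1 := by simp [curl]
  have hc1 : curl (v s) y 1 = fderiv ℝ (v s) y (EuclideanSpace.single 2 (1 : ℝ)) 0 -
      fderiv ℝ (v s) y (EuclideanSpace.single 0 (1 : ℝ)) 2 := by simp [curl]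
  rw [hc1] at h0
  rw [hc0] at h1
  refine ⟨1 - 1 / lam, ?_, ?_, ?_, ?_⟩
  · -- lower bound `δ/(1+δ) ≤ 1 − 1/λ`
    rcases hlam with h | h
    · have hl : lam < 0 := by linarith
      have : 1 / lam < 0 := div_neg_of_pos_of_neg one_pos hl
      have : δ / (1 + δ) < 1 := (div_lt_one (by linarith)).2 (by linarith)
      linarith
    · have hl : 0 < lam := by linarith
      rw [div_le_iff₀ (by linarith : (0:ℝ) < 1 + δ)]
      have h1l : 1 / lam ≤ 1 / (1 + δ) := one_div_le_one_div_of_le (by linarith) h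
      have : (1 - 1 / lam) * (1 + δ) = (1 + δ) - (1 + δ) / lam := by ring
      have h2 : (1 + δ) / lam ≤ 1 := by
        rw [div_le_one hl]; exact h
      nlinarith
  · -- upper bound `1 − 1/λ ≤ 1 + 1/δ`
    rcases hlam with h | h
    · have hl : lam < 0 := by linarith
      have : -(1 / lam) ≤ 1 / δ := by
        rw [show -(1 / lam) = 1 / (-lam) by field_simp]
        exact one_div_le_one_div_of_le hδ (by linarith)
      linarith
    · have hl : 0 < lam := by linarith
      have : 0 < 1 / lam := by positivity
      have : 0 < 1 / δ := by positivity
      linarith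
  · field_simp
    have : lam * fderiv ℝ (v s) y (EuclideanSpace.single 2 (1 : ℝ)) 0 =
        (lam - 1) * fderiv ℝ (v s) y (EuclideanSpace.single 0 (1 : ℝ)) 2 := by linarith
    linarith
  · field_simp
    have : lam * fderiv ℝ (v s) y (EuclideanSpace.single 2 (1 : ℝ)) 1 =
        (lam - 1) * fderiv ℝ (v s) y (EuclideanSpace.single 1 (1 : ℝ)) 2 := by linarith
    linarith

/-- **The elliptic-slope stratum in the stub's currency**: such a profile is not backward-singular at the apex
(conditionally on `divFormLiouville`). -/
theorem nonflatLiouville_of_ellipticShear (hDGNM : Literature.Analysis.PDE.divFormLiouville) (hrate : HasTypeITimeDecay C v)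
    (hcont : ContinuousOn (uncurry v) (Iio (0 : ℝ) ×ˢ univ))
    (hmild : ∀ s t : ℝ, s < t → t < 0 → ∀ x,
      v t x = UnboundedOperators.heatExtension (v s) (t - s) x - oseenDuhamel 1 s v v t x)
    (hdiv : ∀ t < 0, VectorCalculus.IsDivFree (v t)) {s : ℝ} (hs : s < 0)
    (hpol : ∀ y, ⟪curl (v s) y, EuclideanSpace.single 2 1⟫_ℝ = 0)
    {μ₀ μ₁ : ℝ} (hμ₀ : 0 < μ₀)
    (hshear : ∀ y, ∃ m : ℝ, μ₀ ≤ m ∧ m ≤ μ₁ ∧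
      fderiv ℝ (v s) y (EuclideanSpace.single 2 1) 0 = m * fderiv ℝ (v s) y (EuclideanSpace.single 0 1) 2 ∧
      fderiv ℝ (v s) y (EuclideanSpace.single 2 1) 1 = m * fderiv ℝ (v s) y (EuclideanSpace.single 1 1) 2) :
    ¬ IsBackwardSingularPoint v 0 :=
  not_backwardSingular_of_zero (eq_zero_of_ellipticShear hDGNM hrate hcont hmild hdiv hs hpol hμ₀ hshear)

end Summit.NavierStokesRegularity.NavierStokesRegularity.Theorems.PoloidalWindowDoorPoloidalWindowRigidityEllipticSlope
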